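import Summits.SmoothPoincare4.SmoothPoincare4.Theorems.EntropyRungNoncompactShrinkerGapTransplantVolume
import Summits.SmoothPoincare4.SmoothPoincare4.Theorems.EntropyRungNoncompactShrinkerGapTransplantGradient
import Literature.Geometry.Lorentzian.CurvatureRegularity

/-!
# Stub `stub_transplantComparison` (U3) of line `collapsed-ends-usc` —
# change of variables under a `(1 ± η)`-transplant `N × ℝ → M`

Crux `EntropyRung.NoncompactShrinkerGap` (stmt-SmoothPoincare4-10868), line `collapsed-ends-usc`,
registered stub `stub_transplantComparison` (U3). FACT-FREE measure theory and calculus: given a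
smooth compactly supported `W` on `N × ℝ` (supported in `{φ < R} × (-R, R)`) and `ε > 0`, there is
`η > 0` (depending on the model integrals of `W` only) such that for every `η`-transplant
`(U, Φ, Ψ)` of an open `U ⊇ {φ < R} × (-R, R)` into `M` (a local diffeomorphism onto the open
`Φ U` with inverse `Ψ`, `(1-η)(h ⊕ dt²) ≤ Φ^* g ≤ (1+η)(h ⊕ dt²)`, `|R_g ∘ Φ - R_h| ≤ η`) the
transplanted function `w = W ∘ Ψ` (extended by `0`) is smooth, compactly supported, and its
Haslhofer–Müller functional `𝒲̃_M(w)` exceeds the model functional `𝒲̃_{N×ℝ}(W)` by at most `ε`.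

## Proof (helper files `EntropyRungNoncompactShrinkerGapTransplant{Jacobian,SourceChart,Dual,Volume,Gradient}.lean`)

* `volume_image_le_and_le` (file `…Volume`) — **two-sided comparison of `Vol_g(Φ S)` with
  `(dV_h ⊗ dt)(S)`** for measurable `S ⊆ U`: `(1-η)² (dV_h ⊗ dt)(S) ≤ Vol_g(Φ S) ≤ (1+η)² (dV_h ⊗ dt)(S)`.
  Chart by chart: in a chart `φ_N` of `N` the product measure is `√(det h_{ij}(z)) dz dt` on
  `ℝ³ × ℝ` (file `…SourceChart`: the tree's chart formula `lintegral_eq_lintegral_chart` and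
  Tonelli), in a chart `φ_M` of `M` the measure `Vol_g` is `√(det g_{ij}) dx` on `ℝ⁴`; identifying
  `ℝ³ × ℝ ≅ ℝ⁴` by a measure preserving linear map isometric for `|u|² + s²`, Mathlib's Euclidean
  change of variables `lintegral_image_eq_lintegral_abs_det_fderiv_mul` for the injective map
  `φ_M ∘ Φ ∘ (φ_N⁻¹ × id)` reduces the claim to the pointwise Jacobian bounds
  `(1-η)² √det h ≤ |det D(φ_M ∘ Φ ∘ (φ_N⁻¹ × id))| √det g ≤ (1+η)² √det h` (file `…Jacobian`,
  `jacobian_mul_density_bounds`: linearise both metrics and compare determinants of endomorphisms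
  of `ℝ⁴` through `|det T| ≤ K⁴` if `‖T v‖ ≤ K‖v‖`, `k⁴ ≤ |det T|` if `k‖v‖ ≤ ‖T v‖`).
* `lintegral_comp_le_and_le` (file `…Volume`), `integral_transplant_le_and_le` (here) — the
  comparison for integrals of nonnegative functions, `(1-η)² ∫ G ≤ ∫_M (G ∘ Ψ) 1_{Φ U} dV_g ≤ (1+η)² ∫ G`.
* `gradSq_transplant_le` (file `…Gradient`) — `|∇(W ∘ Ψ)|²_g (Φ p) ≤ (1-η)⁻¹ (|∇_N W|²_h + (∂_t W)²)(p)`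
  (dual norms under the quasi-isometric isomorphism `dΦ_p`, `dΨ ∘ dΦ = id`, and
  `dW_{(y,t)}(v, s) = d_N W (v) + s ∂_t W`; file `…Dual` for the inverse-metric inequalities).
* `stub_transplantComparison` — assembly: with `Z_g ∈ [(1-η)² Z, (1+η)² Z]`, the positive and
  negative parts of each term of the numerator distorted by factors in `[(1-η)², (1+η)²/(1-η)]`
  and `R_g ≤ R_h + η`, the total error is `≤ C(W) η` for an explicit constant `C(W)` built from
  the model integrals, so `η = min (1/2) (ε / C(W))` works (`functional_le_of_bounds`, file `…Dual`).

## References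

* H. Federer, *Geometric Measure Theory*, Springer 1969, §3.2.3 (area formula), §3.2.46
  (Hausdorff measure of a Riemannian manifold). [Federer1969]
* I. Chavel, *Riemannian Geometry: A Modern Introduction*, 2nd ed., CUP 2006, §III.3, (III.3.6)
  (integration in local coordinates). [Chavel2006]
-/
noncomputable section

-- the prescribed namespace `Summit.<Summit>.<Problem>.…` repeats `SmoothPoincare4` (summit = problem)
set_option linter.dupNamespace false

namespace Summit.SmoothPoincare4.SmoothPoincare4.Theorems.NoncompactShrinkerGapTransplantComparison

open scoped Manifold ContDiff ENNReal NNReal Topology Bundle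
open MeasureTheory Set
open Literature.Geometry.Lorentzian Literature.Geometry.Riemannian


section Transplant

variable {M : Type*} [TopologicalSpace M] [T2Space M] [ChartedSpace E4 M] [IsManifold (𝓡 4) ∞ M]
  [T3Space M] [MeasurableSpace M] [BorelSpace M]
  {N : Type*} [TopologicalSpace N] [ChartedSpace E3 N] [IsManifold (𝓡 3) ∞ N]
  [T3Space N] [MeasurableSpace N] [BorelSpace N]

open Classical in
/-- **Change of variables under a transplant, integrals of transplanted functions**: with
`g, h, U, Φ, Ψ, η` as in `volume_image_le_and_le` and `G ≥ 0` continuous with compact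
`tsupport G ⊆ U`, the transplant `𝒯G = (G ∘ Ψ) 1_{Φ U}` satisfies
`(1-η)² ∫ G d(V_h ⊗ dt) ≤ ∫ 𝒯G dVol_g ≤ (1+η)² ∫ G d(V_h ⊗ dt)`. [cite: Federer1969, §3.2.3] -/
theorem integral_transplant_le_and_le [SecondCountableTopology M] [SecondCountableTopology N]
    [T2Space N]
    (g : PseudoRiemannianMetric (𝓡 4) ∞ E4 (TangentSpace (𝓡 4) : M → Type _))
    (hg : g.IsRiemannian)
    (h : PseudoRiemannianMetric (𝓡 3) ∞ E3 (TangentSpace (𝓡 3) : N → Type _))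
    (hh : h.IsRiemannian) {U : Set (N × ℝ)} {Φ : N × ℝ → M} {Ψ : M → N × ℝ} {η : ℝ}
    (h0 : 0 ≤ η) (hη : η < 1) (hU : IsOpen U) (hΦ : ContMDiffOn ((𝓡 3).prod 𝓘(ℝ, ℝ)) (𝓡 4) ∞ Φ U)
    (hΦU : IsOpen (Φ '' U)) (hΨ : ContinuousOn Ψ (Φ '' U)) (hinv : ∀ p ∈ U, Ψ (Φ p) = p)
    (hD : ∀ p ∈ U, ∀ (v : E3) (s : ℝ), (1 - η) * (h.val p.1 v v + s ^ 2) ≤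
        g.val (Φ p) (mfderiv ((𝓡 3).prod 𝓘(ℝ, ℝ)) (𝓡 4) Φ p (v, s))
          (mfderiv ((𝓡 3).prod 𝓘(ℝ, ℝ)) (𝓡 4) Φ p (v, s)) ∧
        g.val (Φ p) (mfderiv ((𝓡 3).prod 𝓘(ℝ, ℝ)) (𝓡 4) Φ p (v, s))
          (mfderiv ((𝓡 3).prod 𝓘(ℝ, ℝ)) (𝓡 4) Φ p (v, s)) ≤ (1 + η) * (h.val p.1 v v + s ^ 2))
    {G : N × ℝ → ℝ} (hGc : Continuous G) (hGcs : HasCompactSupport G) (hGU : tsupport G ⊆ U)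
    (hG0 : ∀ p, 0 ≤ G p) :
    (1 - η) ^ 2 * ∫ p, G p ∂(h.riemVolume.prod volume) ≤
        ∫ x, (if x ∈ Φ '' U then G (Ψ x) else 0) ∂g.riemVolume ∧
      ∫ x, (if x ∈ Φ '' U then G (Ψ x) else 0) ∂g.riemVolume ≤
        (1 + η) ^ 2 * ∫ p, G p ∂(h.riemVolume.prod volume) := by
  haveI := isFiniteMeasureOnCompacts_riemVolume g hg
  haveI := isFiniteMeasureOnCompacts_riemVolume h hh
  set μ : Measure (N × ℝ) := h.riemVolume.prod volume with hμ
  set w : M → ℝ := fun x ↦ if x ∈ Φ '' U then G (Ψ x) else 0 with hw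
  obtain ⟨hwc, hagree', hzero', -, hwcs⟩ :=
    continuous_transplant hΦ.continuousOn hΦU hΨ hinv hGc hGcs hGU
  have hagree : ∀ x ∈ Φ '' U, w x = G (Ψ x) := hagree'
  have hzero : ∀ x ∉ Φ '' U, w x = 0 := hzero'
  have hw0 : ∀ x, 0 ≤ w x := fun x ↦ by
    by_cases hx : x ∈ Φ '' U
    · rw [hagree x hx]; exact hG0 _
    · rw [hzero x hx]
  have hGi : Integrable G μ := hGc.integrable_of_hasCompactSupport hGcs
  have hwi : Integrable w g.riemVolume := hwc.integrable_of_hasCompactSupport hwcs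
  have hGeq : ∫ p, G p ∂μ = (∫⁻ p in U, ENNReal.ofReal (G p) ∂μ).toReal := by
    rw [integral_eq_lintegral_of_nonneg_ae (ae_of_all _ hG0) hGc.aestronglyMeasurable]
    congr 1
    refine (setLIntegral_eq_of_support_subset fun p hp ↦ ?_).symm
    have hp' : G p ≠ 0 := fun h0' ↦ hp (by simp [h0'])
    exact hGU (subset_tsupport _ hp')
  have hweq : ∫ x, w x ∂g.riemVolume = (∫⁻ x in Φ '' U, ENNReal.ofReal (G (Ψ x)) ∂g.riemVolume).toReal := by
    rw [integral_eq_lintegral_of_nonneg_ae (ae_of_all _ hw0) hwc.aestronglyMeasurable]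
    congr 1
    rw [← setLIntegral_eq_of_support_subset (μ := g.riemVolume) (s := Φ '' U) (fun x hx ↦ ?_)]
    · exact setLIntegral_congr_fun hΦU.measurableSet fun x hx ↦ by rw [hagree x hx]
    · by_contra hxU
      exact hx (by simp [hzero x hxU])
  have hGm : Measurable fun p ↦ ENNReal.ofReal (G p) := ENNReal.measurable_ofReal.comp hGc.measurable
  obtain ⟨hlo, hhi⟩ := lintegral_comp_le_and_le g hg h hh h0 hη hU hΦ hΦU hΨ hinv hD hGm
  have hfinG : ∫⁻ p in U, ENNReal.ofReal (G p) ∂μ ≠ ⊤ :=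
    ((setLIntegral_le_lintegral _ _).trans_lt hGi.lintegral_lt_top).ne
  have hfinw : ∫⁻ x in Φ '' U, ENNReal.ofReal (G (Ψ x)) ∂g.riemVolume ≠ ⊤ :=
    (hhi.trans_lt (ENNReal.mul_lt_top ENNReal.ofReal_lt_top hfinG.lt_top)).ne
  rw [hGeq, hweq]
  constructor
  · have := ENNReal.toReal_mono hfinw hlo
    rwa [ENNReal.toReal_mul, ENNReal.toReal_ofReal (sq_nonneg _)] at this
  · have := ENNReal.toReal_mono (ENNReal.mul_ne_top ENNReal.ofReal_ne_top hfinG) hhi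
    rwa [ENNReal.toReal_mul, ENNReal.toReal_ofReal (sq_nonneg _)] at this


end Transplant

/-! ### The registered stub -/

/-- **Stub `stub_transplantComparison` (U3) of line `collapsed-ends-usc` of crux
`EntropyRung.NoncompactShrinkerGap`: change of variables under a `(1 ± η)`-transplant
`N × ℝ → M`** (fact-free). Given `W` smooth with compact support in `{φ < R} × (-R, R)` and
`ε > 0`, there is `η > 0` such that for every `η`-transplant `(U, Φ, Ψ)` the transplant
`w = (W ∘ Ψ) 1_{Φ U}` is smooth, compactly supported, `∫ w² dV_g > 0`, and
`𝒲̃_M(w) ≤ 𝒲̃_{N×ℝ}(W) + ε`. Proof: `dV_g = J dV_h dt` with `J ∈ [(1-η)², (1+η)²]`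
(`integral_transplant_le_and_le`), `|∇w|²_g ≤ (1-η)⁻¹ |∇W|²` (`gradSq_transplant_le`),
`R_g ≤ R_h + η`; the model integrals are fixed finite numbers (all integrands are continuous
with compact support), so the total error is `≤ C(W) η` and `η = min (1/2) (ε / C(W))` works
(`functional_le_of_bounds`). Federer 1969, §3.2.3, §3.2.46. [cite: Federer1969, §3.2.3] -/
theorem stub_transplantComparison : ∀ (M : Type) [TopologicalSpace M] [T2Space M] [SecondCountableTopology M] [ChartedSpace E4 M] [IsManifold (𝓡 4) ∞ M] [T3Space M] [MeasurableSpace M] [BorelSpace M] (g : PseudoRiemannianMetric (𝓡 4) ∞ E4 (TangentSpace (𝓡 4) : M → Type _)) [g.HasLeviCivita] (_hg : g.IsRiemannian) (N : Type) [TopologicalSpace N] [T2Space N] [SecondCountableTopology N] [ChartedSpace E3 N] [IsManifold (𝓡 3) ∞ N] [T3Space N] [MeasurableSpace N] [BorelSpace N] (h : PseudoRiemannianMetric (𝓡 3) ∞ E3 (TangentSpace (𝓡 3) : N → Type _)) [h.HasLeviCivita] (_hh : h.IsRiemannian) (φ : N → ℝ) (R : ℝ) (W : N × ℝ → ℝ),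 ContMDiff ((𝓡 3).prod 𝓘(ℝ, ℝ)) 𝓘(ℝ, ℝ) ∞ W → HasCompactSupport W → tsupport W ⊆ {y : N | φ y < R} ×ˢ Set.Ioo (-R) R → 0 < ∫ p, W p ^ 2 ∂(h.riemVolume.prod volume) → ∀ ε : ℝ, 0 < ε → ∃ η : ℝ, 0 < η ∧ ∀ (U : Set (N × ℝ)) (Φ : N × ℝ → M) (Ψ : M → N × ℝ), IsOpen U → {y : N | φ y < R} ×ˢ Set.Ioo (-R) R ⊆ U → ContMDiffOn ((𝓡 3).prod 𝓘(ℝ, ℝ)) (𝓡 4) ∞ Φ U → IsOpen (Φ '' U) → ContMDiffOn (𝓡 4) ((𝓡 3).prod 𝓘(ℝ, ℝ)) ∞ Ψ (Φ '' U) → (∀ p ∈ U, Ψ (Φ p) = p) → (∀ p ∈ U, ∀ (v : E3) (s : ℝ), (1 - η) * (h.val p.1 v v + s ^ 2) ≤ g.val (Φ p) (mfderiv ((𝓡 3).prod 𝓘(ℝ, ℝ)) (𝓡 4) Φ p (v, s)) (mfderiv ((𝓡 3).prod 𝓘(ℝ, ℝ)) (𝓡 4) Φ p (v, s)) ∧ g.val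 (Φ p) (mfderiv ((𝓡 3).prod 𝓘(ℝ, ℝ)) (𝓡 4) Φ p (v, s)) (mfderiv ((𝓡 3).prod 𝓘(ℝ, ℝ)) (𝓡 4) Φ p (v, s)) ≤ (1 + η) * (h.val p.1 v v + s ^ 2)) → (∀ p ∈ U, |g.scalarCurvature (Φ p) - h.scalarCurvature p.1| ≤ η) → ∃ w : M → ℝ, ContMDiff (𝓡 4) 𝓘(ℝ, ℝ) ∞ w ∧ HasCompactSupport w ∧ 0 < ∫ x, w x ^ 2 ∂g.riemVolume ∧ (∫ x, (g.scalarCurvature x * w x ^ 2 + 4 * g.gradSq w x - w x ^ 2 * Real.log (w x ^ 2)) ∂g.riemVolume) / (∫ x, w x ^ 2 ∂g.riemVolume) + Real.log (∫ x, w x ^ 2 ∂g.riemVolume) - Real.log ((4 * Real.pi) ^ 2) - 4 ≤ (∫ p, (h.scalarCurvature p.1 * W p ^ 2 + 4 * (h.gradSq (fun y ↦ W (y, p.2)) p.1 + deriv (fun t ↦ W (p.1, t)) p.2 ^ 2) - W p ^ 2 * Real.log (W p ^ 2)) ∂(h.riemVolume.prod volume)) / (∫ p, W p ^ 2 ∂(h.riemVolume.prod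 volume)) + Real.log (∫ p, W p ^ 2 ∂(h.riemVolume.prod volume)) - Real.log ((4 * Real.pi) ^ 2) - 4 + ε := by
  intro M _ _ _ _ _ _ _ _ g _ hg N _ _ _ _ _ _ _ _ h _ hh φ R W hW hWc hWsupp hZpos ε hε
  classical
  haveI := isFiniteMeasureOnCompacts_riemVolume g hg
  haveI := isFiniteMeasureOnCompacts_riemVolume h hh
  set μ : Measure (N × ℝ) := h.riemVolume.prod volume with hμ
  -- the model integrands
  set Rh : N × ℝ → ℝ := fun p ↦ h.scalarCurvature p.1 with hRh
  set K : N × ℝ → ℝ := fun p ↦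
    h.gradSq (fun y ↦ W (y, p.2)) p.1 + deriv (fun t ↦ W (p.1, t)) p.2 ^ 2 with hK
  set G2 : N × ℝ → ℝ := fun p ↦ W p ^ 2 with hG2
  set GRp : N × ℝ → ℝ := fun p ↦ max (Rh p) 0 * W p ^ 2 with hGRp
  set GRm : N × ℝ → ℝ := fun p ↦ max (-Rh p) 0 * W p ^ 2 with hGRm
  set Gl : N × ℝ → ℝ := fun p ↦ W p ^ 2 * Real.log (W p ^ 2) with hGl
  set Glp : N × ℝ → ℝ := fun p ↦ max (Gl p) 0 with hGlp
  set Glm : N × ℝ → ℝ := fun p ↦ max (-Gl p) 0 with hGlm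
  -- continuity
  have hWcont : Continuous W := hW.continuous
  have hRc : Continuous Rh :=
    (PseudoRiemannianMetric.contMDiff_scalarCurvature h).continuous.comp continuous_fst
  have hKc : Continuous K := (continuous_gradSq_slice h hW).add ((continuous_deriv_slice hW).pow 2)
  have hG2c : Continuous G2 := hWcont.pow 2
  have hGRpc : Continuous GRp := (hRc.max continuous_const).mul hG2c
  have hGRmc : Continuous GRm := (hRc.neg.max continuous_const).mul hG2c
  have hGlc : Continuous Gl := Real.continuous_mul_log.comp hG2c
  have hGlpc : Continuous Glp := hGlc.max continuous_const
  have hGlmc : Continuous Glm := hGlc.neg.max continuous_const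
  -- supports
  have hsW : ∀ {f : N × ℝ → ℝ}, (∀ p, W p = 0 → f p = 0) → Function.support f ⊆ tsupport W :=
    fun hf p hp ↦ subset_tsupport _ (fun hW0 ↦ hp (hf p hW0))
  have hKs : Function.support K ⊆ tsupport W := by
    intro p hp
    by_contra hp'
    obtain ⟨h1, h2⟩ := slice_derivs_eq_zero_of_notMem_tsupport h (W := W) hp'
    exact hp (by simp only [hK, h1, h2]; norm_num)
  have hG2s : Function.support G2 ⊆ tsupport W := hsW fun p hp ↦ by simp [hG2, hp]
  have hGRps : Function.support GRp ⊆ tsupport W := hsW fun p hp ↦ by simp [hGRp, hp]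
  have hGRms : Function.support GRm ⊆ tsupport W := hsW fun p hp ↦ by simp [hGRm, hp]
  have hGlps : Function.support Glp ⊆ tsupport W := hsW fun p hp ↦ by simp [hGlp, hGl, hp]
  have hGlms : Function.support Glm ⊆ tsupport W := hsW fun p hp ↦ by simp [hGlm, hGl, hp]
  have hcs : ∀ {f : N × ℝ → ℝ}, Function.support f ⊆ tsupport W → HasCompactSupport f :=
    fun hf ↦ HasCompactSupport.intro hWc fun p hp ↦ Function.notMem_support.1 fun h' ↦ hp (hf h')
  have hint : ∀ {f : N × ℝ → ℝ}, Continuous f → Function.support f ⊆ tsupport W → Integrable f μ :=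
    fun hf hs ↦ hf.integrable_of_hasCompactSupport (hcs hs)
  -- the model integrals (fixed finite numbers)
  set Z : ℝ := ∫ p, W p ^ 2 ∂μ with hZdef
  set aRp : ℝ := ∫ p, GRp p ∂μ with haRp
  set aRm : ℝ := ∫ p, GRm p ∂μ with haRm
  set aK : ℝ := ∫ p, K p ∂μ with haK
  set aLp : ℝ := ∫ p, Glp p ∂μ with haLp
  set aLm : ℝ := ∫ p, Glm p ∂μ with haLm
  have hK0 : ∀ p, 0 ≤ K p := fun p ↦ add_nonneg (hh.gradSq_nonneg _ _) (sq_nonneg _)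
  have haRp0 : 0 ≤ aRp := integral_nonneg fun p ↦ mul_nonneg (le_max_right _ _) (sq_nonneg _)
  have haRm0 : 0 ≤ aRm := integral_nonneg fun p ↦ mul_nonneg (le_max_right _ _) (sq_nonneg _)
  have haK0 : 0 ≤ aK := integral_nonneg hK0
  have haLp0 : 0 ≤ aLp := integral_nonneg fun p ↦ le_max_right _ _
  have haLm0 : 0 ≤ aLm := integral_nonneg fun p ↦ le_max_right _ _
  have hNumModel : ∫ p, (h.scalarCurvature p.1 * W p ^ 2 +
      4 * (h.gradSq (fun y ↦ W (y, p.2)) p.1 + deriv (fun t ↦ W (p.1, t)) p.2 ^ 2) -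
      W p ^ 2 * Real.log (W p ^ 2)) ∂μ = aRp - aRm + 4 * aK - (aLp - aLm) := by
    have hpt : ∀ p, h.scalarCurvature p.1 * W p ^ 2 +
        4 * (h.gradSq (fun y ↦ W (y, p.2)) p.1 + deriv (fun t ↦ W (p.1, t)) p.2 ^ 2) -
        W p ^ 2 * Real.log (W p ^ 2) = (GRp p - GRm p + 4 * K p) - (Glp p - Glm p) := by
      intro p
      simp only [hGRp, hGRm, hK, hGlp, hGlm, hGl, hRh]
      rw [max_zero_sub_max_neg_zero_eq_self, ← sub_mul, max_zero_sub_max_neg_zero_eq_self]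
    simp_rw [hpt]
    have i1 : Integrable (fun p ↦ GRp p - GRm p) μ := (hint hGRpc hGRps).sub (hint hGRmc hGRms)
    have i2 : Integrable (fun p ↦ 4 * K p) μ := (hint hKc hKs).const_mul 4
    have i3 : Integrable (fun p ↦ GRp p - GRm p + 4 * K p) μ := i1.add i2
    have i4 : Integrable (fun p ↦ Glp p - Glm p) μ := (hint hGlpc hGlps).sub (hint hGlmc hGlms)
    rw [integral_sub i3 i4, integral_add i1 i2, integral_sub (hint hGRpc hGRps) (hint hGRmc hGRms),
      integral_sub (hint hGlpc hGlps) (hint hGlmc hGlms), integral_const_mul]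
  -- the constant and `η`
  set C₁ : ℝ := 3 * aRp + 2 * aRm + 32 * aK + 2 * aLp + 3 * aLm with hC₁
  set C : ℝ := 12 * |aRp - aRm + 4 * aK - aLp + aLm| / Z + 4 * C₁ / Z + 4 with hC
  have hC₁0 : 0 ≤ C₁ := by rw [hC₁]; linarith
  have hC0 : 0 < C := by
    have h1 : 0 ≤ 12 * |aRp - aRm + 4 * aK - aLp + aLm| / Z := by positivity
    have h2 : 0 ≤ 4 * C₁ / Z := by positivity
    rw [hC]; linarith
  set η : ℝ := min (1 / 2) (ε / C) with hηdef
  have hη0 : 0 < η := lt_min (by norm_num) (div_pos hε hC0)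
  have hη1 : η ≤ 1 / 2 := min_le_left _ _
  have hη1' : η < 1 := by linarith
  have hηC : η * C ≤ ε := (le_div_iff₀ hC0).1 (min_le_right _ _)
  refine ⟨η, hη0, ?_⟩
  intro U Φ Ψ hU hsubU hΦ hΦU hΨ hinv hD hR
  have hWU : tsupport W ⊆ U := hWsupp.trans hsubU
  -- the transplant
  set w : M → ℝ := fun x ↦ if x ∈ Φ '' U then W (Ψ x) else 0 with hw
  have hwsmooth : ContMDiff (𝓡 4) 𝓘(ℝ, ℝ) ∞ w := contMDiff_transplant hΦ hΦU hΨ hinv hW hWc hWU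
  obtain ⟨hwc, hagree', hzero', htsw, hwcs⟩ :=
    continuous_transplant hΦ.continuousOn hΦU hΨ.continuousOn hinv hWcont hWc hWU
  have hagree : ∀ x ∈ Φ '' U, w x = W (Ψ x) := hagree'
  have hzero : ∀ x ∉ Φ '' U, w x = 0 := hzero'
  have htswU : tsupport w ⊆ Φ '' U := htsw.trans (image_mono hWU)
  -- transplants of the model integrands and their integrals
  have hT : ∀ {G : N × ℝ → ℝ}, Continuous G → Function.support G ⊆ tsupport W → (∀ p, 0 ≤ G p) →
      (1 - η) ^ 2 * ∫ p, G p ∂μ ≤ ∫ x, (if x ∈ Φ '' U then G (Ψ x) else 0) ∂g.riemVolume ∧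
      ∫ x, (if x ∈ Φ '' U then G (Ψ x) else 0) ∂g.riemVolume ≤ (1 + η) ^ 2 * ∫ p, G p ∂μ :=
    fun hGc hGs hG0 ↦ integral_transplant_le_and_le g hg h hh hη0.le hη1' hU hΦ hΦU
      hΨ.continuousOn hinv hD hGc (hcs hGs) ((closure_minimal hGs (isClosed_tsupport W)).trans hWU)
      hG0
  have hTi : ∀ {G : N × ℝ → ℝ}, Continuous G → Function.support G ⊆ tsupport W →
      Integrable (fun x ↦ if x ∈ Φ '' U then G (Ψ x) else 0) g.riemVolume := by
    intro G hGc hGs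
    obtain ⟨hc, -, -, -, hcs'⟩ := continuous_transplant hΦ.continuousOn hΦU hΨ.continuousOn hinv
      hGc (hcs hGs) ((closure_minimal hGs (isClosed_tsupport W)).trans hWU)
    exact hc.integrable_of_hasCompactSupport hcs'
  -- `Z_g`
  set Zg : ℝ := ∫ x, w x ^ 2 ∂g.riemVolume with hZgdef
  have hw2 : (fun x ↦ w x ^ 2) = fun x ↦ if x ∈ Φ '' U then G2 (Ψ x) else 0 := by
    funext x
    by_cases hx : x ∈ Φ '' U
    · rw [if_pos hx, hagree x hx]
    · rw [if_neg hx, hzero x hx]; ring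
  obtain ⟨hZg1, hZg2⟩ : (1 - η) ^ 2 * Z ≤ Zg ∧ Zg ≤ (1 + η) ^ 2 * Z := by
    rw [hZgdef, hw2]
    exact hT hG2c hG2s fun p ↦ sq_nonneg _
  have hZg0 : 0 < Zg := lt_of_lt_of_le (mul_pos (pow_pos (by linarith) 2) hZpos) hZg1
  -- the curvature term
  set bR : ℝ := ∫ x, g.scalarCurvature x * w x ^ 2 ∂g.riemVolume with hbRdef
  have hRgc : Continuous g.scalarCurvature :=
    (PseudoRiemannianMetric.contMDiff_scalarCurvature g).continuous
  have hsw : ∀ {f : M → ℝ}, (∀ x, w x = 0 → f x = 0) → Function.support f ⊆ tsupport w :=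
    fun hf x hx ↦ subset_tsupport _ (fun hw0 ↦ hx (hf x hw0))
  have hintM : ∀ {f : M → ℝ}, Continuous f → Function.support f ⊆ tsupport w →
      Integrable f g.riemVolume :=
    fun hf hs ↦ hf.integrable_of_hasCompactSupport
      (HasCompactSupport.intro hwcs fun x hx ↦ Function.notMem_support.1 fun h' ↦ hx (hs h'))
  have hbRi : Integrable (fun x ↦ g.scalarCurvature x * w x ^ 2) g.riemVolume :=
    hintM (hRgc.mul (hwc.pow 2)) (hsw fun x hx ↦ by simp [hx])
  have hw2i : Integrable (fun x ↦ w x ^ 2) g.riemVolume :=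
    hintM (hwc.pow 2) (hsw fun x hx ↦ by simp [hx])
  have hbR : bR ≤ (1 + η) ^ 2 * aRp - (1 - η) ^ 2 * aRm + η * Zg := by
    have hpt : ∀ x, g.scalarCurvature x * w x ^ 2 ≤
        (if x ∈ Φ '' U then GRp (Ψ x) else 0) - (if x ∈ Φ '' U then GRm (Ψ x) else 0) +
          η * w x ^ 2 := by
      intro x
      by_cases hx : x ∈ Φ '' U
      · obtain ⟨p, hp, rfl⟩ := hx
        rw [if_pos (mem_image_of_mem Φ hp), if_pos (mem_image_of_mem Φ hp),
          hagree _ (mem_image_of_mem Φ hp), hinv p hp]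
        simp only [hGRp, hGRm, hRh]
        rw [← sub_mul, max_zero_sub_max_neg_zero_eq_self, ← add_mul]
        have hR' : g.scalarCurvature (Φ p) ≤ h.scalarCurvature p.1 + η := by
          have := (abs_le.1 (hR p hp)).2; linarith
        exact mul_le_mul_of_nonneg_right hR' (sq_nonneg _)
      · rw [if_neg hx, if_neg hx, hzero x hx]; norm_num
    calc bR ≤ ∫ x, ((if x ∈ Φ '' U then GRp (Ψ x) else 0) -
          (if x ∈ Φ '' U then GRm (Ψ x) else 0) + η * w x ^ 2) ∂g.riemVolume :=
          integral_mono hbRi (((hTi hGRpc hGRps).sub (hTi hGRmc hGRms)).add (hw2i.const_mul η)) hpt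
      _ = ∫ x, (if x ∈ Φ '' U then GRp (Ψ x) else 0) ∂g.riemVolume -
            ∫ x, (if x ∈ Φ '' U then GRm (Ψ x) else 0) ∂g.riemVolume + η * Zg := by
          have i1 : Integrable (fun x ↦ (if x ∈ Φ '' U then GRp (Ψ x) else 0) -
              (if x ∈ Φ '' U then GRm (Ψ x) else 0)) g.riemVolume :=
            (hTi hGRpc hGRps).sub (hTi hGRmc hGRms)
          have i2 : Integrable (fun x ↦ η * w x ^ 2) g.riemVolume := hw2i.const_mul η
          rw [integral_add i1 i2, integral_sub (hTi hGRpc hGRps) (hTi hGRmc hGRms),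
            integral_const_mul]
      _ ≤ (1 + η) ^ 2 * aRp - (1 - η) ^ 2 * aRm + η * Zg := by
          have h1 := (hT hGRpc hGRps fun p ↦ mul_nonneg (le_max_right _ _) (sq_nonneg _)).2
          have h2 := (hT hGRmc hGRms fun p ↦ mul_nonneg (le_max_right _ _) (sq_nonneg _)).1
          linarith
  -- the gradient term
  set bK : ℝ := ∫ x, g.gradSq w x ∂g.riemVolume with hbKdef
  have hgradc : Continuous (g.gradSq w) := (contMDiff_gradSq g hwsmooth).continuous
  have hgrads : Function.support (g.gradSq w) ⊆ tsupport w := fun x hx ↦ by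
    by_contra hx'
    exact hx (gradSq_eq_zero_of_notMem_tsupport g hx')
  have hbKi : Integrable (g.gradSq w) g.riemVolume := hintM hgradc hgrads
  have hbK : bK ≤ (1 + η) ^ 2 / (1 - η) * aK := by
    have h1η : 0 < 1 - η := by linarith
    have hpt : ∀ x, g.gradSq w x ≤ (if x ∈ Φ '' U then K (Ψ x) else 0) / (1 - η) := by
      intro x
      by_cases hx : x ∈ Φ '' U
      · obtain ⟨p, hp, rfl⟩ := hx
        rw [if_pos (mem_image_of_mem Φ hp), hinv p hp]
        exact gradSq_transplant_le g hg h hh hη1' hU hΦ hΦU hΨ hinv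
          (fun p hp v s ↦ (hD p hp v s).1) hW hp
      · rw [if_neg hx, zero_div]
        exact (gradSq_eq_zero_of_notMem_tsupport g (fun h' ↦ hx (htswU h'))).le
    calc bK ≤ ∫ x, (if x ∈ Φ '' U then K (Ψ x) else 0) / (1 - η) ∂g.riemVolume :=
          integral_mono hbKi ((hTi hKc hKs).div_const _) hpt
      _ = (∫ x, (if x ∈ Φ '' U then K (Ψ x) else 0) ∂g.riemVolume) / (1 - η) :=
          integral_div _ _
      _ ≤ ((1 + η) ^ 2 * aK) / (1 - η) :=
          div_le_div_of_nonneg_right (hT hKc hKs hK0).2 h1η.le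
      _ = (1 + η) ^ 2 / (1 - η) * aK := by ring
  -- the entropy terms
  set bLp : ℝ := ∫ x, max (w x ^ 2 * Real.log (w x ^ 2)) 0 ∂g.riemVolume with hbLpdef
  set bLm : ℝ := ∫ x, max (-(w x ^ 2 * Real.log (w x ^ 2))) 0 ∂g.riemVolume with hbLmdef
  have hwLp : (fun x ↦ max (w x ^ 2 * Real.log (w x ^ 2)) 0) =
      fun x ↦ if x ∈ Φ '' U then Glp (Ψ x) else 0 := by
    funext x
    by_cases hx : x ∈ Φ '' U
    · rw [if_pos hx, hagree x hx]
    · rw [if_neg hx, hzero x hx]; simp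
  have hwLm : (fun x ↦ max (-(w x ^ 2 * Real.log (w x ^ 2))) 0) =
      fun x ↦ if x ∈ Φ '' U then Glm (Ψ x) else 0 := by
    funext x
    by_cases hx : x ∈ Φ '' U
    · rw [if_pos hx, hagree x hx]
    · rw [if_neg hx, hzero x hx]; simp
  have hbLp : (1 - η) ^ 2 * aLp ≤ bLp := by
    rw [hbLpdef, hwLp]; exact (hT hGlpc hGlps fun p ↦ le_max_right _ _).1
  have hbLm : bLm ≤ (1 + η) ^ 2 * aLm := by
    rw [hbLmdef, hwLm]; exact (hT hGlmc hGlms fun p ↦ le_max_right _ _).2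
  have hbLpi : Integrable (fun x ↦ max (w x ^ 2 * Real.log (w x ^ 2)) 0) g.riemVolume := by
    rw [hwLp]; exact hTi hGlpc hGlps
  have hbLmi : Integrable (fun x ↦ max (-(w x ^ 2 * Real.log (w x ^ 2))) 0) g.riemVolume := by
    rw [hwLm]; exact hTi hGlmc hGlms
  -- the numerator on `M`
  have hNumTarget : ∫ x, (g.scalarCurvature x * w x ^ 2 + 4 * g.gradSq w x -
      w x ^ 2 * Real.log (w x ^ 2)) ∂g.riemVolume = bR + 4 * bK - (bLp - bLm) := by
    have hpt : ∀ x, g.scalarCurvature x * w x ^ 2 + 4 * g.gradSq w x -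
        w x ^ 2 * Real.log (w x ^ 2) = (g.scalarCurvature x * w x ^ 2 + 4 * g.gradSq w x) -
        (max (w x ^ 2 * Real.log (w x ^ 2)) 0 - max (-(w x ^ 2 * Real.log (w x ^ 2))) 0) := by
      intro x; rw [max_zero_sub_max_neg_zero_eq_self]
    simp_rw [hpt]
    have i1 : Integrable (fun x ↦ 4 * g.gradSq w x) g.riemVolume := hbKi.const_mul 4
    have i2 : Integrable (fun x ↦ g.scalarCurvature x * w x ^ 2 + 4 * g.gradSq w x)
        g.riemVolume := hbRi.add i1
    have i3 : Integrable (fun x ↦ max (w x ^ 2 * Real.log (w x ^ 2)) 0 -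
        max (-(w x ^ 2 * Real.log (w x ^ 2))) 0) g.riemVolume := hbLpi.sub hbLmi
    rw [integral_sub i2 i3, integral_add hbRi i1, integral_sub hbLpi hbLmi, integral_const_mul]
  -- assembly
  refine ⟨w, hwsmooth, hwcs, hZg0, ?_⟩
  rw [hNumTarget, hNumModel]
  have hmain := functional_le_of_bounds (ε := ε) haRp0 haRm0 haK0 haLp0 haLm0 hZpos hη0 hη1 hηC
    hZg1 hZg2 hbR hbK hbLp hbLm
  linarith









end Summit.SmoothPoincare4.SmoothPoincare4.Theorems.NoncompactShrinkerGapTransplantComparison
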